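import Mathlib
import HarnessLib
import Summits.NavierStokesRegularity.NavierStokesRegularity.Theorems.PlaneStrainDoorZoomSpaceTimeDecay
import Summits.NavierStokesRegularity.NavierStokesRegularity.Theorems.PlaneStrainDoorProfileWindowToSlab
import Literature.Analysis.FluidPDE.MillerMiddleEigenvalueGronwall

/-!
# nsreg-p1 ROUND-15: the three ENSTROPHY-MONOTONE WINDOW DOORS S16 «production-free window», S16′ «plane-strain
# window», S16γ «tube strain» — THE DOORS THEMSELVES, PROVED

The door TEXTS of nsreg-p1 `r15/Sketch16.lean` (`Target`, `TargetPlaneStrain`, `TargetTubeStrain`, with the sketch's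
`stretchF` / `strainDet` / `MidStrainMajorant` unfolded) as sorry-free tree theorems: for a classical Leray–Hopf solution
from rapidly decaying data which is locally SPACE–TIME Type I at `(x₀,T)`,

* `target_productionFree` — if the scale-normalised enstrophy production `(T−t)³ ω·Sω(t, x₀ + √(T−t)y)` fades in `L¹`
  over ONE nonempty open similarity window, `x₀` is backward bounded (door S16);
* `target_planeStrain` — the same with Betchov's invariant `(T−t)³ det(∇u + ∇uᵀ)` (door S16′);
* `target_tubeStrain` — if `λ₂⁺ = o(1/(T−t))` uniformly on every similarity annulus (two-frame form), `x₀` is backward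
  bounded (door S16γ).

Assembly = the sketch's (ported K1 `PlaneStrainDoorZoomSpaceTimeDecay.spaceTimeDoor_of_profileWindowRigidity` /
`hasTypeIDecay_of_zoom` + the tree zoom `localPointZoomVelGradSlices`) ∘ (the profile cruxes PROVED today:
`productionFreeProfileRigidity`, `planeStrainProfileRigidity` — window forms, `PlaneStrainDoorProfileWindowToSlab` — and
`tubeStrainProfileRigidity`, `PlaneStrainDoorProfileLiouvilles`, all through the profile-enstrophy engine
`PlaneStrainDoorProfileEnstrophyLiouville`).  Credit: door design, texts and the K1 proofs nsreg-p1 g13; engine and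
profile cruxes nsreg-p6 g8.  WHAT THIS IS NOT: not NS regularity (Clay A) — three CONDITIONAL one-point, one-window
regularity criteria under LOCAL SPACE–TIME Type I; not a route open (the planned S16 route would be moot-by-proof).
-/

noncomputable section

-- the summit and its single sub-problem share the name (CONVENTIONS §1)
set_option linter.dupNamespace false

namespace Summit.NavierStokesRegularity.NavierStokesRegularity.Theorems.PlaneStrainDoorTargets

open MeasureTheory Set Function Filter Topology Metric
open scoped RealInnerProductSpace InnerProductSpace NNReal ENNReal
open Literature.Analysis Literature.Analysis.FluidPDE
open Summit.NavierStokesRegularity.NavierStokesRegularity.Theorems.LocalSineTubeDoorLocalPointZoomGradSlices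
open Summit.NavierStokesRegularity.NavierStokesRegularity.Theorems.PlaneStrainDoorZoomSpaceTimeDecay
open Summit.NavierStokesRegularity.NavierStokesRegularity.Theorems.PlaneStrainDoorProfileLiouvilles
open Summit.NavierStokesRegularity.NavierStokesRegularity.Theorems.PlaneStrainDoorProfileWindowToSlab

/-! ## Doors S16 and S16′ -/

/-- **DOOR S16 «production-free window» (text of nsreg-p1 r15/Sketch16 `Target`, `stretchF` unfolded), PROVED.**
A classical Leray–Hopf flow from rapidly decaying data, locally SPACE–TIME Type I at `(x₀,T)`, whose scale-normalised
enstrophy production `(T−t)³ ω·Sω (t, x₀ + √(T−t) y)` fades in `L¹` over ONE nonempty open similarity window `U`, is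
backward bounded at `x₀`. -/
theorem target_productionFree :
    ∀ (ν T : ℝ), 0 < ν → 0 < T → ∀ (u : ℝ → EuclideanSpace ℝ (Fin 3) → EuclideanSpace ℝ (Fin 3))
      (p : ℝ → EuclideanSpace ℝ (Fin 3) → ℝ),
    IsClassicalNSSolutionOn (Set.Ico 0 T) ν 0 u p →
    IsLerayHopfOn T ν 0 (u 0) u →
    HasRapidSpatialDecay (u 0) →
    ∀ (x₀ : EuclideanSpace ℝ (Fin 3)) (ρ M : ℝ), 0 < ρ →
    (∀ t ∈ Set.Ico 0 T, T - ρ ^ 2 < t → ∀ x ∈ Metric.ball x₀ ρ,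
        ‖u t x‖ * (‖x - x₀‖ + Real.sqrt (ν * (T - t))) ≤ M) →
    ∀ (U : Set (EuclideanSpace ℝ (Fin 3))), IsOpen U → U.Nonempty →
    Filter.Tendsto (fun t => ∫⁻ y in U, ENNReal.ofReal
        |inner ℝ (curlCLM (Real.sqrt (T - t) ^ 2 • fderiv ℝ (u t) (x₀ + Real.sqrt (T - t) • y)))
          ((Real.sqrt (T - t) ^ 2 • fderiv ℝ (u t) (x₀ + Real.sqrt (T - t) • y))
            (curlCLM (Real.sqrt (T - t) ^ 2 • fderiv ℝ (u t) (x₀ + Real.sqrt (T - t) • y))))|)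
      (nhdsWithin T (Set.Iio T)) (nhds 0) →
    IsBackwardBoundedAt u T x₀ :=
  spaceTimeDoor_of_profileWindowRigidity
    (fun A : EuclideanSpace ℝ (Fin 3) →L[ℝ] EuclideanSpace ℝ (Fin 3) => inner ℝ (curlCLM A) (A (curlCLM A)))
    continuous_stretch stretch_zeroSetInvariant productionFreeProfileRigidity

/-- **DOOR S16′ «plane-strain window» (text of nsreg-p1 r15/Sketch16 `TargetPlaneStrain`, `strainDet` unfolded), PROVED.**
The same with Betchov's invariant `(T−t)³ det (∇u + ∇uᵀ)(t, x₀ + √(T−t) y)`. -/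
theorem target_planeStrain :
    ∀ (ν T : ℝ), 0 < ν → 0 < T → ∀ (u : ℝ → EuclideanSpace ℝ (Fin 3) → EuclideanSpace ℝ (Fin 3))
      (p : ℝ → EuclideanSpace ℝ (Fin 3) → ℝ),
    IsClassicalNSSolutionOn (Set.Ico 0 T) ν 0 u p →
    IsLerayHopfOn T ν 0 (u 0) u →
    HasRapidSpatialDecay (u 0) →
    ∀ (x₀ : EuclideanSpace ℝ (Fin 3)) (ρ M : ℝ), 0 < ρ →
    (∀ t ∈ Set.Ico 0 T, T - ρ ^ 2 < t → ∀ x ∈ Metric.ball x₀ ρ,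
        ‖u t x‖ * (‖x - x₀‖ + Real.sqrt (ν * (T - t))) ≤ M) →
    ∀ (U : Set (EuclideanSpace ℝ (Fin 3))), IsOpen U → U.Nonempty →
    Filter.Tendsto (fun t => ∫⁻ y in U, ENNReal.ofReal
        |((Real.sqrt (T - t) ^ 2 • fderiv ℝ (u t) (x₀ + Real.sqrt (T - t) • y)) +
          ContinuousLinearMap.adjoint (Real.sqrt (T - t) ^ 2 • fderiv ℝ (u t) (x₀ + Real.sqrt (T - t) • y))).det|)
      (nhdsWithin T (Set.Iio T)) (nhds 0) →
    IsBackwardBoundedAt u T x₀ :=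
  spaceTimeDoor_of_profileWindowRigidity
    (fun A : EuclideanSpace ℝ (Fin 3) →L[ℝ] EuclideanSpace ℝ (Fin 3) => (A + ContinuousLinearMap.adjoint A).det)
    continuous_strainDet strainDet_zeroSetInvariant planeStrainProfileRigidity

/-! ## The middle principal strain along the zoom -/

/-- Two-frame form ⇒ `λ₂ ≤ m`. -/
theorem midStrain_le_of_twoFrame {A : EuclideanSpace ℝ (Fin 3) →L[ℝ] EuclideanSpace ℝ (Fin 3)} {m : ℝ}
    (h : ∃ a b : EuclideanSpace ℝ (Fin 3), ‖a‖ = 1 ∧ ‖b‖ = 1 ∧ inner ℝ a b = 0 ∧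
      ∀ α β : ℝ, inner ℝ (A (α • a + β • b)) (α • a + β • b) ≤ m * (α ^ 2 + β ^ 2)) :
    strainEigenvalues (A : EuclideanSpace ℝ (Fin 3) →ₗ[ℝ] EuclideanSpace ℝ (Fin 3)) finrank_euclideanSpace_fin 1 ≤ m := by
  obtain ⟨a, b, ha, hb, hab, hq⟩ := h
  exact (strainEigenvalues_mid_le_iff (A : EuclideanSpace ℝ (Fin 3) →ₗ[ℝ] EuclideanSpace ℝ (Fin 3))
    finrank_euclideanSpace_fin m).2 ⟨a, b, ha, hb, hab, fun α β => by
      simpa only [ContinuousLinearMap.coe_coe] using hq α β⟩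

/-- `λ₂ ≤ m` ⇒ two-frame form. -/
theorem twoFrame_of_midStrain_le {A : EuclideanSpace ℝ (Fin 3) →L[ℝ] EuclideanSpace ℝ (Fin 3)} {m : ℝ}
    (h : strainEigenvalues (A : EuclideanSpace ℝ (Fin 3) →ₗ[ℝ] EuclideanSpace ℝ (Fin 3)) finrank_euclideanSpace_fin 1 ≤ m) :
    ∃ a b : EuclideanSpace ℝ (Fin 3), ‖a‖ = 1 ∧ ‖b‖ = 1 ∧ inner ℝ a b = 0 ∧
      ∀ α β : ℝ, inner ℝ (A (α • a + β • b)) (α • a + β • b) ≤ m * (α ^ 2 + β ^ 2) := by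
  obtain ⟨a, b, ha, hb, hab, hq⟩ := (strainEigenvalues_mid_le_iff
    (A : EuclideanSpace ℝ (Fin 3) →ₗ[ℝ] EuclideanSpace ℝ (Fin 3)) finrank_euclideanSpace_fin m).1 h
  exact ⟨a, b, ha, hb, hab, fun α β => by simpa only [ContinuousLinearMap.coe_coe] using hq α β⟩

/-- Scaling: `λ₂(cA) ≤ c m` for `c ≥ 0` when `λ₂(A) ≤ m`. -/
theorem midStrain_smul_le {A : EuclideanSpace ℝ (Fin 3) →L[ℝ] EuclideanSpace ℝ (Fin 3)} {m c : ℝ} (hc : 0 ≤ c)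
    (h : strainEigenvalues (A : EuclideanSpace ℝ (Fin 3) →ₗ[ℝ] EuclideanSpace ℝ (Fin 3)) finrank_euclideanSpace_fin 1 ≤ m) :
    strainEigenvalues ((c • A : EuclideanSpace ℝ (Fin 3) →L[ℝ] EuclideanSpace ℝ (Fin 3)) :
      EuclideanSpace ℝ (Fin 3) →ₗ[ℝ] EuclideanSpace ℝ (Fin 3)) finrank_euclideanSpace_fin 1 ≤ c * m := by
  obtain ⟨a, b, ha, hb, hab, hq⟩ := twoFrame_of_midStrain_le h
  refine midStrain_le_of_twoFrame ⟨a, b, ha, hb, hab, fun α β => ?_⟩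
  change inner ℝ (c • A (α • a + β • b)) (α • a + β • b) ≤ c * m * (α ^ 2 + β ^ 2)
  rw [real_inner_smul_left, mul_assoc]
  exact mul_le_mul_of_nonneg_left (hq α β) hc

/-- Closedness of `{A | λ₂(A) ≤ m}` along a convergent sequence (the middle principal strain is Lipschitz). -/
theorem midStrain_le_of_tendsto {A : ℕ → EuclideanSpace ℝ (Fin 3) →L[ℝ] EuclideanSpace ℝ (Fin 3)}
    {B : EuclideanSpace ℝ (Fin 3) →L[ℝ] EuclideanSpace ℝ (Fin 3)} {m : ℝ}
    (hA : Tendsto A atTop (𝓝 B))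
    (hm : ∀ᶠ j in atTop, strainEigenvalues (A j : EuclideanSpace ℝ (Fin 3) →ₗ[ℝ] EuclideanSpace ℝ (Fin 3))
      finrank_euclideanSpace_fin 1 ≤ m) :
    strainEigenvalues (B : EuclideanSpace ℝ (Fin 3) →ₗ[ℝ] EuclideanSpace ℝ (Fin 3)) finrank_euclideanSpace_fin 1 ≤ m :=
  le_of_tendsto ((lipschitzWith_midStrain.continuous.tendsto B).comp hA) hm

/-- `λ₂ ≤ η/σ` for every `η > 0` forces `λ₂ ≤ 0`. -/
theorem midStrain_nonpos_of_forall {B : EuclideanSpace ℝ (Fin 3) →L[ℝ] EuclideanSpace ℝ (Fin 3)} {σ : ℝ} (hσ : 0 < σ)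
    (h : ∀ η : ℝ, 0 < η → strainEigenvalues (B : EuclideanSpace ℝ (Fin 3) →ₗ[ℝ] EuclideanSpace ℝ (Fin 3))
      finrank_euclideanSpace_fin 1 ≤ η / σ) :
    strainEigenvalues (B : EuclideanSpace ℝ (Fin 3) →ₗ[ℝ] EuclideanSpace ℝ (Fin 3)) finrank_euclideanSpace_fin 1 ≤ 0 := by
  set l := strainEigenvalues (B : EuclideanSpace ℝ (Fin 3) →ₗ[ℝ] EuclideanSpace ℝ (Fin 3)) finrank_euclideanSpace_fin 1
    with hl
  refine le_of_not_gt fun hlt => ?_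
  have h1 := h (l * σ / 2) (by positivity)
  have h2 : l * σ / 2 / σ = l / 2 := by field_simp
  rw [h2] at h1
  linarith

/-! ## Door S16γ -/

/-- **DOOR S16γ «tube strain everywhere» (text of nsreg-p1 r15/Sketch16 `TargetTubeStrain`, `MidStrainMajorant` unfolded),
PROVED.**  Local space–time Type I at `(x₀,T)` and `λ₂⁺ = o(1/(T−t))` uniformly on every similarity annulus
`a√(T−t) ≤ ‖x−x₀‖ ≤ b√(T−t)` (two-frame form) ⇒ `x₀` is backward bounded.  Proof (the sketch's, ported): along the
tree's zoom the rescaled gradients at `κ/2 < κ := ‖y‖/√((−s)/ν) < 2κ` have `λ₂ ≤ η/(−s)` eventually, closedness of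
`{λ₂ ≤ c}` and `η ↓ 0` give `λ₂(∇v(s,y)) ≤ 0` off the axis point; the profile has space–time decay
(`hasTypeIDecay_of_zoom`) and is therefore regular by `tubeStrainProfileRigidity`. -/
theorem target_tubeStrain :
    ∀ (ν T : ℝ), 0 < ν → 0 < T → ∀ (u : ℝ → EuclideanSpace ℝ (Fin 3) → EuclideanSpace ℝ (Fin 3))
      (p : ℝ → EuclideanSpace ℝ (Fin 3) → ℝ),
    IsClassicalNSSolutionOn (Set.Ico 0 T) ν 0 u p →
    IsLerayHopfOn T ν 0 (u 0) u →
    HasRapidSpatialDecay (u 0) →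
    ∀ (x₀ : EuclideanSpace ℝ (Fin 3)) (ρ M : ℝ), 0 < ρ →
    (∀ t ∈ Set.Ico 0 T, T - ρ ^ 2 < t → ∀ x ∈ Metric.ball x₀ ρ,
        ‖u t x‖ * (‖x - x₀‖ + Real.sqrt (ν * (T - t))) ≤ M) →
    (∀ a b η : ℝ, 0 < a → a < b → 0 < η → ∀ᶠ t in nhdsWithin T (Set.Iio T), ∀ x : EuclideanSpace ℝ (Fin 3),
        a * Real.sqrt (T - t) ≤ ‖x - x₀‖ → ‖x - x₀‖ ≤ b * Real.sqrt (T - t) →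
        ∃ v w : EuclideanSpace ℝ (Fin 3), ‖v‖ = 1 ∧ ‖w‖ = 1 ∧ inner ℝ v w = 0 ∧
          ∀ α β : ℝ, inner ℝ (fderiv ℝ (u t) x (α • v + β • w)) (α • v + β • w) ≤ η / (T - t) * (α ^ 2 + β ^ 2)) →
    IsBackwardBoundedAt u T x₀ := by
  intro ν T hν hT u p hcl hLH hdec x₀ ρ M hρ hM hann
  by_contra hnot
  obtain ⟨C, v, lam, hlam, hlam0, ⟨hrate, hcont, hmild, hdiv⟩, hsing, hconv⟩ :=
    localPointZoomVelGradSlices ν T hν hT u p hcl hLH hdec x₀ ρ M hρ (timeTypeI_of_spaceTimeTypeI hM) hnot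
  have hdecay : HasTypeIDecay (M / ν) v :=
    hasTypeIDecay_of_zoom hν hT hρ hlam hlam0 hM fun s hs y => (hconv s hs y).1
  refine tubeStrainProfileRigidity C (M / ν) v hrate hdecay hcont hmild hdiv (fun s hs y hy => ?_) hsing
  have hns : 0 < -s := neg_pos.2 hs
  -- zoom times
  have hTt : ∀ j : ℕ, T - (T + lam j ^ 2 * s / ν) = lam j ^ 2 * ((-s) / ν) := fun j => by ring
  have htlt : ∀ j : ℕ, T + lam j ^ 2 * s / ν < T := fun j => by
    have : 0 < lam j ^ 2 * ((-s) / ν) := mul_pos (pow_pos (hlam j) 2) (div_pos hns hν)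
    linarith [hTt j]
  have htT : Tendsto (fun j : ℕ => T + lam j ^ 2 * s / ν) atTop (𝓝 T) := by
    have h1 : Tendsto (fun j => T + lam j ^ 2 * s / ν) atTop (𝓝 (T + 0 ^ 2 * s / ν)) :=
      tendsto_const_nhds.add (((hlam0.pow 2).mul_const s).div_const ν)
    simpa using h1
  have htT' : Tendsto (fun j : ℕ => T + lam j ^ 2 * s / ν) atTop (nhdsWithin T (Set.Iio T)) :=
    tendsto_nhdsWithin_iff.2 ⟨htT, Eventually.of_forall fun j => htlt j⟩
  -- the similarity radius of the zoom points
  have hsq : 0 < Real.sqrt ((-s) / ν) := Real.sqrt_pos.2 (div_pos hns hν)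
  have hS0 : Real.sqrt ((-s) / ν) ≠ 0 := hsq.ne'
  have hy' : 0 < ‖y‖ := norm_pos_iff.2 hy
  set κ : ℝ := ‖y‖ / Real.sqrt ((-s) / ν) with hκ
  have hκpos : 0 < κ := div_pos hy' hsq
  have hyκ : ‖y‖ = κ * Real.sqrt ((-s) / ν) := by rw [hκ, div_mul_cancel₀ _ hS0]
  have hsqrtT : ∀ j : ℕ, Real.sqrt (T - (T + lam j ^ 2 * s / ν)) = lam j * Real.sqrt ((-s) / ν) :=
    fun j => by rw [hTt j, Real.sqrt_mul (pow_nonneg (hlam j).le 2), Real.sqrt_sq (hlam j).le]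
  have hdist : ∀ j : ℕ, ‖x₀ + lam j • y - x₀‖ = lam j * ‖y‖ := fun j => by
    rw [add_sub_cancel_left, norm_smul, Real.norm_eq_abs, abs_of_pos (hlam j)]
  -- for every `η > 0` the rescaled gradients eventually have middle strain `≤ η/(−s)`
  have hev : ∀ η : ℝ, 0 < η → ∀ᶠ j : ℕ in atTop, strainEigenvalues
      (((lam j ^ 2 / ν) • fderiv ℝ (u (T + lam j ^ 2 * s / ν)) (x₀ + lam j • y) :
        EuclideanSpace ℝ (Fin 3) →L[ℝ] EuclideanSpace ℝ (Fin 3)) :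
        EuclideanSpace ℝ (Fin 3) →ₗ[ℝ] EuclideanSpace ℝ (Fin 3)) finrank_euclideanSpace_fin 1 ≤ η / (-s) := by
    intro η hη
    have h := htT'.eventually (hann (κ / 2) (2 * κ) η (half_pos hκpos) (by linarith) hη)
    filter_upwards [h] with j hj
    have hpos : 0 < lam j * (κ * Real.sqrt ((-s) / ν)) := mul_pos (hlam j) (mul_pos hκpos hsq)
    have h1 : κ / 2 * Real.sqrt (T - (T + lam j ^ 2 * s / ν)) ≤ ‖x₀ + lam j • y - x₀‖ := by
      rw [hsqrtT, hdist, hyκ]; nlinarith [hpos]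
    have h2 : ‖x₀ + lam j • y - x₀‖ ≤ 2 * κ * Real.sqrt (T - (T + lam j ^ 2 * s / ν)) := by
      rw [hsqrtT, hdist, hyκ]; nlinarith [hpos]
    have hmaj := midStrain_le_of_twoFrame (hj (x₀ + lam j • y) h1 h2)
    have hc : 0 ≤ lam j ^ 2 / ν := (div_pos (pow_pos (hlam j) 2) hν).le
    have hscale := midStrain_smul_le hc hmaj
    have hl0 : lam j ≠ 0 := (hlam j).ne'
    have hν0 : ν ≠ 0 := hν.ne'
    have hs0 : -s ≠ 0 := hns.ne'
    have heq : lam j ^ 2 / ν * (η / (T - (T + lam j ^ 2 * s / ν))) = η / (-s) := by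
      rw [hTt j]; field_simp
    rwa [heq] at hscale
  -- pass to the limit `j → ∞`, then `η ↓ 0`
  have hlim : ∀ η : ℝ, 0 < η → strainEigenvalues (fderiv ℝ (v s) y :
      EuclideanSpace ℝ (Fin 3) →ₗ[ℝ] EuclideanSpace ℝ (Fin 3)) finrank_euclideanSpace_fin 1 ≤ η / (-s) := fun η hη =>
    midStrain_le_of_tendsto (hconv s hs y).2 (hev η hη)
  exact twoFrame_of_midStrain_le (midStrain_nonpos_of_forall hns hlim)

end Summit.NavierStokesRegularity.NavierStokesRegularity.Theorems.PlaneStrainDoorTargets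

end
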